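import Mathlib
import HarnessLib

/-!
# The theta series through POISSON SUMMATION: `Θ_G(u) = u⁻¹ Σ_{n ∈ ℤ} Ĝ(n/u)` and the majorant `‖Θ_G(u)‖ ≤ u⁻¹ Σ_n ‖Ĝ(n/u)‖`
# for a continuous compactly supported profile vanishing on `(−∞, 0]` (RH-FREE)

WEIL column (LADDER-RH, W-P(P2); crux `ThetaCertificateSound`): step (D1-core) of cc-s2-3's THETA-KERNEL-BLUEPRINT §5. For a continuous
compactly supported `G : ℝ → ℂ` with `G = 0` on `(−∞, 0]` and `u > 0`, Mathlib's Poisson summation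
(`Real.tsum_eq_tsum_fourier_of_rpow_decay_of_summable`) applied to `y ↦ G(u y)` gives
`Σ_{n ≥ 1} G(n u) = u⁻¹ Σ_{n ∈ ℤ} 𝓕G(n/u)` whenever the right side is summable; when moreover `∫ G = 0` the `n = 0` term
vanishes (`𝓕G(0) = ∫ G`), which is the source of the smallness of the theta series of PART XIX (handoff-idea-2; cc-s2-6
THETA-CERT-cc6 §D1: `|Θ(u)| ≤ M(u)` after the explicit bound `|ĥ(ξ)| ≤ (Σ|cᵢ|/|2πξ|)(m/(2πε|ξ|))^m`, which is NOT done here).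
* `fourier_comp_mul` — dilation: `𝓕(y ↦ G(u y))(ξ) = u⁻¹ · 𝓕G(ξ/u)` (`u > 0`);
* `tsum_nat_eq_tsum_int_of_vanish` — `Σ_{n ≥ 1} G(n u)` as a sum over `ℤ`;
* **`thetaSum_eq_inv_mul_tsum_fourier`**, **`norm_thetaSum_le_inv_mul_tsum`** — the identity and the majorant (the `n = 0` term is
  `𝓕G 0 = ∫ G`, tree: `Literature.NumberTheory.LFunctions.DFIDeterminant.fourier_zero_eq_integral`).
Nothing here bears on the truth of RH.
-/

set_option linter.dupNamespace false

noncomputable section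

open MeasureTheory Set Filter Complex Asymptotics
open scoped Real FourierTransform

namespace Summit.RiemannHypothesis.RiemannHypothesis.Theorems.WeilColumn.ThetaMellin

/-- **Dilation rule** for the real Fourier transform: `𝓕(y ↦ G(u y))(ξ) = u⁻¹ 𝓕G(ξ/u)` for `u > 0`. [folklore] -/
theorem fourier_comp_mul (G : ℝ → ℂ) {u : ℝ} (hu : 0 < u) (ξ : ℝ) :
    𝓕 (fun y : ℝ => G (u * y)) ξ = (u⁻¹ : ℂ) * 𝓕 G (ξ / u) := by
  rw [Real.fourier_real_eq_integral_exp_smul, Real.fourier_real_eq_integral_exp_smul]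
  have h := MeasureTheory.Measure.integral_comp_mul_left
    (fun v : ℝ => Complex.exp (↑(-2 * π * (v / u) * ξ) * Complex.I) • G v) u
  have e : ∀ x : ℝ, u * x / u = x := fun x => by field_simp
  simp only [e] at h
  rw [h, abs_of_pos (inv_pos.mpr hu), Complex.real_smul, Complex.ofReal_inv]
  congr 1
  refine integral_congr_ae (Eventually.of_forall fun v => ?_)
  simp only
  congr 3
  push_cast
  field_simp

/-- For `G` vanishing on `(−∞, 0]`, the sum over `n ≥ 1` of `G(n u)` is the sum over `n ∈ ℤ` (`u > 0`). [folklore] -/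
theorem tsum_nat_eq_tsum_int_of_vanish {G : ℝ → ℂ} (hneg : ∀ y ≤ 0, G y = 0) {u : ℝ} (hu : 0 < u)
    (hs : Summable fun n : ℤ => G (n * u)) :
    ∑' n : ℕ, G (((n + 1 : ℕ) : ℝ) * u) = ∑' n : ℤ, G (n * u) := by
  set F : ℤ → ℂ := fun k => G (k * u) with hF
  have h1 : Summable fun n : ℕ => F n := hs.comp_injective Nat.cast_injective
  have hinj : Function.Injective fun n : ℕ => -((n : ℤ) + 1) := fun a b h => by
    simp only [neg_inj, add_left_inj, Nat.cast_inj] at h; exact h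
  have h2 : Summable fun n : ℕ => F (-(n + 1)) := hs.comp_injective hinj
  have hneg' : ∀ n : ℕ, F (-(n + 1)) = 0 := by
    intro n
    rw [hF]
    apply hneg
    have e : (((-((n : ℤ) + 1) : ℤ)) : ℝ) = -((n : ℝ) + 1) := by push_cast; ring
    rw [e]
    nlinarith
  have hzero : F 0 = 0 := by rw [hF]; exact hneg _ (by simp)
  calc ∑' n : ℕ, G (((n + 1 : ℕ) : ℝ) * u) = ∑' n : ℕ, F ((n + 1 : ℕ) : ℤ) := by
        refine tsum_congr fun n => ?_
        rw [hF]; push_cast; rfl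
    _ = ∑' n : ℕ, F (n : ℤ) := by
        rw [Summable.tsum_eq_zero_add h1]
        push_cast
        rw [hzero, zero_add]
    _ = (∑' n : ℕ, F (n : ℤ)) + ∑' n : ℕ, F (-(n + 1)) := by
        rw [tsum_congr hneg', tsum_zero, add_zero]
    _ = ∑' n : ℤ, F n := (tsum_of_nat_of_neg_add_one h1 h2).symm

/-- **THE THETA SERIES BY POISSON SUMMATION.** `G` continuous with compact support, `G = 0` on `(−∞, 0]`, `u > 0`, and
`Σ_{n ∈ ℤ} 𝓕G(n/u)` summable ⇒ `Σ_{n ≥ 1} G(n u) = u⁻¹ Σ_{n ∈ ℤ} 𝓕G(n/u)`. [folklore; Mathlib Poisson summation] -/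
theorem thetaSum_eq_inv_mul_tsum_fourier {G : ℝ → ℂ} (hc : Continuous G) (hsupp : HasCompactSupport G)
    (hneg : ∀ y ≤ 0, G y = 0) {u : ℝ} (hu : 0 < u) (hsum : Summable fun n : ℤ => 𝓕 G (n / u)) :
    ∑' n : ℕ, G (((n + 1 : ℕ) : ℝ) * u) = (u⁻¹ : ℂ) * ∑' n : ℤ, 𝓕 G (n / u) := by
  set f : ℝ → ℂ := fun y => G (u * y) with hf
  have hfc : Continuous f := hc.comp (continuous_const.mul continuous_id)
  have hfsupp : HasCompactSupport f := by
    refine hsupp.comp_homeomorph (Homeomorph.mulLeft₀ u hu.ne') |>.mono ?_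
    intro x hx; simpa [hf, Homeomorph.mulLeft₀] using hx
  -- decay of f at infinity (compact support ⇒ any power)
  have hfO : f =O[cocompact ℝ] fun x : ℝ => |x| ^ (-(2 : ℝ)) := by
    obtain ⟨R, hR⟩ := hfsupp.isCompact.isBounded.subset_closedBall 0
    refine IsBigO.of_bound 0 ?_
    rw [cocompact_eq_atBot_atTop, Filter.eventually_sup]
    constructor
    · filter_upwards [eventually_lt_atBot (-R)] with x hx
      have : x ∉ tsupport f := fun h => by
        have := hR h; rw [Metric.mem_closedBall, dist_zero_right, Real.norm_eq_abs] at this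
        have : -R ≤ x := by linarith [abs_le.mp this |>.1]
        linarith
      rw [image_eq_zero_of_notMem_tsupport this, norm_zero, zero_mul]
    · filter_upwards [eventually_gt_atTop R] with x hx
      have : x ∉ tsupport f := fun h => by
        have := hR h; rw [Metric.mem_closedBall, dist_zero_right, Real.norm_eq_abs] at this
        linarith [abs_le.mp this |>.2]
      rw [image_eq_zero_of_notMem_tsupport this, norm_zero, zero_mul]
  -- Fourier coefficients of f
  have hFf : ∀ n : ℤ, 𝓕 f n = (u⁻¹ : ℂ) * 𝓕 G (n / u) := fun n => fourier_comp_mul G hu n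
  have hsumf : Summable fun n : ℤ => 𝓕 f n := by
    simp_rw [hFf]; exact hsum.mul_left _
  have P := Real.tsum_eq_tsum_fourier_of_rpow_decay_of_summable hfc one_lt_two hfO hsumf 0
  simp only [zero_add, QuotientAddGroup.mk_zero, fourier_eval_zero, mul_one] at P
  -- left side: Σ_{n∈ℤ} f n = Σ_{n≥1} G(n u)
  have hsG : Summable fun n : ℤ => G (n * u) := by
    have : Summable fun n : ℤ => f n := by
      -- the left side of Poisson is summable: finitely many nonzero terms
      obtain ⟨R, hR⟩ := hfsupp.isCompact.isBounded.subset_closedBall 0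
      refine summable_of_hasFiniteSupport ((Set.finite_Icc (-⌈R⌉) ⌈R⌉).subset ?_)
      intro n hn
      rw [Function.mem_support] at hn
      have hmem : (n : ℝ) ∈ tsupport f := by
        by_contra h; exact hn (image_eq_zero_of_notMem_tsupport h)
      have := hR hmem
      rw [Metric.mem_closedBall, dist_zero_right, Real.norm_eq_abs] at this
      have h1 := abs_le.mp this
      constructor
      · have : (-(⌈R⌉ : ℤ) : ℝ) ≤ n := by linarith [Int.le_ceil R]
        exact_mod_cast this
      · have : (n : ℝ) ≤ (⌈R⌉ : ℤ) := by linarith [Int.le_ceil R]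
        exact_mod_cast this
    refine this.congr fun n => ?_
    simp [hf, mul_comm]
  rw [tsum_nat_eq_tsum_int_of_vanish hneg hu hsG]
  have e1 : ∑' n : ℤ, G (n * u) = ∑' n : ℤ, f n := tsum_congr fun n => by simp [hf, mul_comm]
  rw [e1, P]
  simp_rw [hFf]
  rw [tsum_mul_left]

/-- **POISSON MAJORANT** (D1-core of the kernel theta certificate): under the same hypotheses,
`‖Σ_{n ≥ 1} G(n u)‖ ≤ u⁻¹ Σ_{n ∈ ℤ} ‖𝓕G(n/u)‖`; when `∫ G = 0` the `n = 0` term is `‖𝓕G 0‖ = ‖∫ G‖ = 0`, so only `n ≠ 0`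
contribute (`𝓕G 0 = ∫ G` is the tree's `Literature.NumberTheory.LFunctions.DFIDeterminant.fourier_zero_eq_integral`). [folklore] -/
theorem norm_thetaSum_le_inv_mul_tsum {G : ℝ → ℂ} (hc : Continuous G) (hsupp : HasCompactSupport G)
    (hneg : ∀ y ≤ 0, G y = 0) {u : ℝ} (hu : 0 < u) (hsum : Summable fun n : ℤ => ‖𝓕 G (n / u)‖) :
    ‖∑' n : ℕ, G (((n + 1 : ℕ) : ℝ) * u)‖ ≤ u⁻¹ * ∑' n : ℤ, ‖𝓕 G (n / u)‖ := by
  rw [thetaSum_eq_inv_mul_tsum_fourier hc hsupp hneg hu hsum.of_norm, norm_mul, norm_inv, Complex.norm_real,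
    Real.norm_of_nonneg hu.le]
  exact mul_le_mul_of_nonneg_left (norm_tsum_le_tsum_norm hsum) (inv_nonneg.mpr hu.le)

end Summit.RiemannHypothesis.RiemannHypothesis.Theorems.WeilColumn.ThetaMellin
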